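import Mathlib
import Summits.ValiantsHypothesis.ValiantsHypothesis.Theorems.NNDivisionHard.Negative.CliqueRowLawFalse
import Summits.ValiantsHypothesis.ValiantsHypothesis.Theorems.NNDivisionHard.Negative.DiagTiltedLawFalse
import Summits.ValiantsHypothesis.ValiantsHypothesis.Theorems.NNDivisionHard.Negative.LocatedPencilLawFalse
import Literature.Barriers.PneNP.TSPExtensionComplexityKaibelWeltge
import Literature.Barriers.PneNP.TSPExtensionComplexityHyperplaneBound
import Summits.ValiantsHypothesis.ValiantsHypothesis.Theorems.FifoMatchingGridCorShadowOfCliqueFace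
import Summits.ValiantsHypothesis.ValiantsHypothesis.Theorems.FifoMatchingNNDivisionHardLocatedRowsTogetherFaceWeight
import Summits.ValiantsHypothesis.ValiantsHypothesis.Theorems.FifoMatchingNNDivisionHardLocatedRowsPrivateCeiling
import Summits.ValiantsHypothesis.ValiantsHypothesis.Theorems.NNDivisionHard.Negative.LocatedRowsChain
import Summits.ValiantsHypothesis.ValiantsHypothesis.Theorems.FifoMatchingNNDivisionHardExactPencilReadCube
import Summits.ValiantsHypothesis.ValiantsHypothesis.Theorems.FifoMatchingNNDivisionHardExactIsVirtualGraph
import Summits.ValiantsHypothesis.ValiantsHypothesis.Theorems.FifoMatchingNNDivisionHardPencilCollapse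
import Summits.ValiantsHypothesis.ValiantsHypothesis.Theorems.FifoMatchingNNDivisionHardLocalizationUPatFace
import Summits.ValiantsHypothesis.ValiantsHypothesis.Theorems.FifoMatchingNNDivisionHardPovertyBarrier
import Summits.ValiantsHypothesis.ValiantsHypothesis.Theorems.FifoMatchingNNDivisionHardConePricingTwistedFace
import Summits.ValiantsHypothesis.ValiantsHypothesis.Theorems.FifoMatchingXcDivisionChamberCertificate
import Summits.ValiantsHypothesis.ValiantsHypothesis.Theorems.FifoMatchingNNDivisionHardLocalizationPatternSplitDefects
import Summits.ValiantsHypothesis.ValiantsHypothesis.Theorems.FifoMatchingNNDivisionHardExactPencilSubexpCube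
import HarnessLib

/-!
# Census40 — THE C′ CENSUS OF RECORD, BY NAME (val-idea-40 lineage; crux `NNDivisionHard`, stmt-ValiantsHypothesis-21181; director-valiant R331 (2)(e), R334, R336 (2), R354 (1), R360 (1), R362 (2); desk #399 (D2))

REV 13.8 of the census (was `Cruxes/NNDivisionHard/LocatedRows.lean` §8, revs 11–12; rev 13 @ef0b7efb1e14; rev 13.1 @e9a8b2974909; rev 13.2 @1e424a74c919; rev 13.3 @138d498e1bd2; rev 13.4 @65d69ceac529; rev 13.5 @ce82db65eb46; rev 13.6 @f65e8afc2789; rev 13.7 @d6414a25c0e4).  MOVED to this workfile because `LocatedRows.lean` sits at the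
200 000 B workfile cap (rev 12 = 189 714 B) — val-idea-crit-9 g3 V#105b plan (a) ACCEPTED; `LocatedRows.lean` rev 13 keeps a pointer here.  Same sibling
namespace `…Cruxes.NNDivisionHard.ValIdea40Census` (so short names `LocatedRows.X`, `ExactPencil.X`, `ExactIsVirtual.X` denote the LANDED
`…Theorems.FifoMatching.*` declarations); imports LANDED `Theorems/` modules only (last ✓ `ExactPencil` port part = `FifoMatchingNNDivisionHardExactPencilReadCube`, whose import chain carries
parts 1–15; `…ExactIsVirtualGraph` ⊇ `…ExactIsVirtual`).  NOTHING here is restated or re-proved: every conjunct is a landed theorem cited BY NAME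
(`decided_species_of_record` rev 12 unchanged; `currencies_of_record` = row V; `exactPencil_species_of_record` = rows 3–9/E/C of the port; `exactPencil_cube_species_of_record` = rows 10/11/E-cube (parts 14/15); `pencil_collapse_of_record` = row P; `genus_functor_of_record` = row G (E-U) engine; via the
`StatementOf @decl` device — a Prop-valued abbreviation that names a landed theorem's statement without retyping it; Cruxes-only by V#105b (2), never to be
ported to `Theorems/`).

REV LOG: 13.1 (40 g6 @e9a8b2974909 = c0924609613c2de8, crit-9 V#134) · 13.2 (39 g6 @1e424a74c919 = 30cb9b62fd8ec907, one writer R354 (1)/R360 (1), δ-read crit-9 g4: rows P′ and §8c T1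
flipped to THEOREMS by name — `poverty_barrier_of_record`, `twisted_face_of_record`; row S2′ = S2-K1/K2/K3 + S2-LL; (E-7) pointer → THEOREMS ✓ p692595) · 13.3 (40 g8, one writer R360 (1)/R362 (2), δ-read crit-9 g4): EXACTLY the five pending rows folded in crit-9 g4's
endorsed wordings VERBATIM — §8a rows 12 (38c affine-cube floor, V#140b) / 13 (41 SHORT LISTS, V#143c; by name `short_lists_of_record`) / G′ (41 PATTERN SPLIT, §2(d) + V#141a (β)),
§8b row E4 (40 GENERIC VIRTUAL HARDNESS, V#143b + V#145a numeral), §8d S2-K4′ / S2-K5 (+ H″ clause V#147a (i)) / S2-LL½ / S2-N (39, V#143a (δ)); row L → LINE REV 25 784ea0ad630c532f;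
consequential pointer clauses in §8c T2 / §8e ((E-5‴) footnote floor, (E-7) count floor); `LocatedRows.lean` untouched; nothing else moved. · 13.4 (40 g8 = WRITER named by director-valiant R376 (1); fold list of record crit-9 g4 V#158 / R376 (1); = rev 13.3 @138d498e1bd2 (3cca7358f3e1b1c6) + exactly: (α) row 12 LEVEL → THEOREMS by name
`subexp_cube_of_record` (ExactPencil38c port 16a ✓ p694581 / 16b ✓ p694683, V#149a / V#157c); (β) `pattern_split_of_record` + 3 conjuncts of PART B ✓ p695482 by name + import
`…LocalizationPatternSplitDefects` (V#156a / V#156b); S2 source pointer → `AsymmetricWindow39` REV 4 @1064d0978540 and «AW39 §1–§4 → THEOREMS 4/4» (✓ p693237 · p695032 · p695658 · p696383)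
as LEVEL annotations on rows S2′ / S2-K4′ / S2-K5; (γ) pointer «LL-1 ⇐ LL-1(M̄_{λ,k})» in the S2-LL clause (V#157a); content frozen by R376 (1) / R377 (ε); labels; nothing else moved). · 13.5 (40 g8; = rev 13.4 @65d69ceac529
(aaca6d2ec7a01514) + (ε): ONE §8b CALIBRATION row `TC` (41 g7 TROPICAL CALIBRATION by Theorems name ✓ p697445 / ✓ p697602), licensed director-valiant R378 (1) / R383 (2), wording crit-9 g4 V#163 (iii) / V#169a
verbatim; + (h2) row S2 LEVEL annotation «RealLambda39 → THEOREMS 6/6» (✓ p691577 · p691951 · p695029 · p695512 · p695958 · p695984; V#159b / V#170); Lean declarations unchanged; labels; nothing else moved). · 13.6 (crit-9 g4 =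
WRITER as scribe, director-valiant R391 (1); = rev 13.5 @ce82db65eb46 (23bed670a56ec9f2) + ONE clause swap in §8b row `TC`: the constant-term cofactor tier is DECIDED, not OPEN
— by name `NNOrderRung.constantTerm_cofactor_hard` ∘ ✓ 27271 (correction of crit-9's own (ε) wording, V#175 / V#176b / V#179; 41 g8 by name, 42 g6 BN-g6-3(b), 38 g8 BN-g8-3); Lean declarations unchanged; labels; nothing else moved). · 13.7 (crit-9 g5 = WRITER as scribe, director-valiant R395 (2) trigger pre-licensed on the critic's PASS of 39 g7's THEOREM A; = rev 13.6 @f65e8afc2789 (d990ba8d87135cfa) + ONE fold item in §8d row `S2′`, clause S2-LL, exactly as pre-priced crit-9 g4 V#180b (a)–(c) / PASS crit-9 g5 V#184a: (a) the (γ) pointer «LL-1 ⇐ LL-1(M̄_{λ,k})» is TRUE but VOID — LL-1(M̄_{λ,k}) is FALSE: ONE BLOCK IS EASY (39 g7, kernel Cruxes `SingleBlock39.lean` rev 1 @a4c4c4447d28 = 25f39ee6d8a34698, ★ `SingleBlock39.pencilBar_hasNonnegFactorization`, explicit nonnegative factorisation, 0 sorry, std axioms); (b) memo R3 «located exactness is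 worthless» heuristic STRUCK; (c) the S2 window for the PENCIL is a pure S_n-GLUING question; Lean declarations unchanged; labels; nothing else moved). · 13.8 (crit-9 g5 = WRITER as scribe, director-valiant R407 (2) pre-licence / R411 (2) licence = option (β) of crit-9 g5 V#189b, trigger NOW (both items in hand); = rev 13.7 @d6414a25c0e4 (b63feec2484deea4) + TWO kernel-cited items: (i) ONE new §8b row `WA` directly below row `TC`: the WINDOW-AVOIDANCE tier of `NNDivisionHard` is DECIDED by name (40 g9, kernel Cruxes `WindowAvoidance40.lean` rev 1 @191f77618e6f = 504f968d46d70df7, ★ `WindowAvoidance40.nnDivisionHard_of_windowAvoidingMonomial`, 0 sorry, std axioms; crit-9 g5 V#185b KEEP «new at crux level as a decided membership test by name; new-combination as mechanism; empty on C′» / V#186c PASS) and the residual of 21181 in h-language is TYPED (`nnDivisionHard_iff_denseDeepResidual`: WINDOW-DENSE ∧ DEEP); species / crux-calibration axis, same standing as the constant-term tier (R405 (3) / R407 (2)); (ii) ONE phrase in §8d row `S2′`, clause S2-LL, after «n-exponent of one block = 2 exactly …»: the n-free term of one block is NECESSARY — rank₊ M̄_{λ,k} ≥ 2^{Ω(min(k,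 n−k, λ^{−1/2}))} (39 g7 ★★ `SingleBlock39.singleBlock_visible`, kernel Cruxes `SingleBlock39.lean` REV 2 @d9b2c862ee4b = 0d2697041b13d7a0, 1 155 l., 0 sorry, std axioms — REV 1 @a4c4c4447d28 byte-preserved + §7; crit-9 g5 V#189a KEEP-optional / V#190a PASS; director R411 (1)), so one block = Θ(n²) + an n-free term in [2^{Ω(√h)}, (k+1)·2^{h(h+2)}], power of h open; S2-lane calibration; Lean declarations unchanged; labels; nothing else moved).

CENSUS TABLE (rev 13.8 — FORMAT OF RECORD, director-valiant R334/R336 (2), crit-9 g3 V#97 §5 / V#101a / V#105b): columns GENUS · MEMBERSHIP TEST ·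
LEVEL ∈ {kernel ✓pid (Theorems; enters the Lean conjunctions BY NAME) | kernel (Cruxes `module` @rev; not importable, cited as text) | staged (sha16) | paper} ·
PROOF ROUTE ∈ {law body = exact-pencil maxima | top law = direct slack bound | T0 = passenger budget} (since ✓ p688316 `exactPencilLaw_iff_corVirtualHardN`
C′ ≡ COR-VIRTUAL in THEOREMS, so «law body / top law» is a proof-route distinction, NOT a level) · RATE · MODULE/DECL.  GENUS I = `UPat` OF RECORD
(«no-UDISJ-pattern» support certificates, 43 rev 5, V#119a / clause (E-U); ⊇ the kernel class `Face Quiet` = «one top on a free face», row G); genus II = BUDGETED VALUE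
certificates (41, row X: column-wise partial common maximisers, twins); TWO genera stand (V#119a).

§8a DECIDED SPECIES OF C′ (the T∞ list: the law HOLDS on them, in kernel unless marked)
| # | class | genus | membership test (kernel name) | level | proof route · decls (law body / top law) | rate | module |
|---|---|---|---|---|---|---|---|
| 1 | PIN-EXPOSED passengers (⊇ 1a zero-diagonal cube of record `Q∘` via `pinExposed_qOff`/`columnCoupled_qOff`, 1b diagonal permutahedron `pinExposed_qPerm`, TEN = S-injective lists `distinctS_decided`) | I | `LocatedRows.PinExposed n K q` | kernel ✓ p681115 · p681292 · p680583 · p681523 | `exactTilted_law_on_pinExposed`, `…_holds_on_qOff`, `…_holds_on_qPerm` / `pinExposed_decided`, `qPerm_decided` | `3^{n−|S|} ≤ (r+1)·2^{n−|S|}` | `…LocatedRows.*` |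
| 2 | COLUMN-COUPLED affine cubes | I | `LocatedRows.ColumnCoupled G` | kernel ✓ p681292 | `exactTilted_law_on_columnCoupled` / `columnCoupled_decided` | column block | `…LocatedRows.*` |
| 3 | the PAIR CUBE `Q_pair` | I | instance | kernel ✓ p686733 | `exactTilted_law_holds_on_qPair` / `cor_add_qPair_decided` | `k = ⌊n/2⌋` | `…ExactPencilQPairDecided` |
| 4 | ZERO-DIAGONAL DIFFERENCE cubes, scaled | I | `IsZgenCube` / `IsScaledZgenCube` | kernel ✓ p687254 · p688077 | `exactTilted_law_holds_on_zgenCube` / `cor_add_zgenCube_decided`, `cor_add_scaledZgenCube_decided` | `k = ⌊n/2⌋` | `…ExactPencilZgenCube`, `…ScaledZgenCube` |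
| 5 | SPARSE-GENERATOR cubes = NINE (cube form), WINDOW CLOSED FROM ABOVE | I | generator column supports `< s`, `s·K(c,n) ≤ n` | kernel ✓ p689501 · p690370 | — / `cor_add_sparseCube_decided`, ★ `cor_add_sparseCube_decided_window` | `3^k ≤ (r+1)·2^k`, `k = ⌊n/s⌋` | `…DeadBlocks`, `…Window` |
| 6 | SPARSE-DIFFERENCE lists = NINE (list form), window form | I | pairwise-difference column supports `< s` | kernel ✓ p689680 · p690370 | — / `cor_add_sparseDiff_decided`, ★ `cor_add_sparseDiff_decided_window` | `k = ⌊n/s⌋` | `…PairsRead`, `…Window` |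
| 7 | TOUCH-Z-OR-SPARSE (`Z = β⁻¹D`, `2|Z| ≤ n/s`) | I | entries of differences dead-or-sparse | kernel ✓ p690134 | — / `cor_add_touchOrSparse_decided` | `3^{k−|D|} ≤ (r+1)·2^{k−|D|}` | `…ColumnHit` |
| 8 | COLUMN-HIT = ELEVEN (⊇ every list with `2K² ≤ n` points; `COR(n)+CUT(n)`) | I | `Z ∋` a nonzero column of every nonzero pairwise difference | kernel ✓ p690134 | — / `cor_add_columnHit_decided`, `cor_add_fewVertex_decided`, `cor_add_cut_bound` | `3^{n−|Z|} ≤ (r+1)·2^{n−|Z|}` | `…ColumnHit` |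
| 9 | FUNCTION GRAPHS = TWELVE (`PM(K_n)`, Birkhoff, maps) | I | `graphMat` family | kernel ✓ p690134 · p690370 | `exactTilted_lawBody_funcGraph` / `cor_add_funcGraph_decided` | `k = ⌊n/2⌋` | `…ColumnHit`, `…Window` |
| 10 | FAT / STICK-OUT cubes AT POLYLOG SCALE: ∃ ι, `|ι| ≥ K(c,n)`, every nonzero generator has an entry off `ι×ι` (⊇ `> K(c,n)` nonzero columns-or-rows per generator ⊇ V#109's `Z_h`, `s₀ > K`; supersedes S43-4's `⌊√h⌋` for full cube lists) = INSTANCE of E at `(Z,β) = (ιᶜ, singletons)` | I | `hG`/`hfat` hypotheses | kernel ✓ p690741 | `exactTilted_lawBody_stickOutCube` / `cor_add_bound_of_stickOutCube`, `cor_add_stickOutCube_decided`, `cor_add_fatCube_decided`, `cor_add_fatColumnsCube_decided`, `cor_add_fatRowsCube_decided` | `3^{|ι|} ≤ (r+1)·2^{|ι|}` | `…StickOut` (38 g3 §13b; V#113, V#116b) |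
| 11 | FEW-GENERATOR cubes `N ≤ n − K(c,n)` — NO hypothesis on the generators | I | `N ≤ n − K(c,n)` | kernel ✓ p691147 | — / `cor_add_fewGenCube_decided` (via `cor_add_stickOutCube_decided`, hitting set: one row index per nonzero generator, `|Z| ≤ N`, every generator sticks out of `Zᶜ × Zᶜ`; 38's wording, V#130d (t7)) | as 10 | `…ReadCube` (38 g3 §13c; V#116c) |
| 12 | AFFINE CUBE PASSENGERS WITH `N + K(c,n) < 2^{⌊n/4K⌋}` GENERATORS: DECIDED, kernel (V#140b) — every `Q₀ + Σ_{t∈P}[G t]`, `K = K(c,n) = 2(log₂ n + c)^c + 6`, NO hypothesis on `Q₀`/`G` (⊇ row 11; = the ZONOTOPE CLOSURE LEMMA now in kernel, superseding the paper «`N ≤ 2^{n/(2K)−2}`» of 38 g3 (C)(3), V#113c; (E-5‴) footnote floor of record «`N ≥ 2^{⌊n/(4K)⌋} − K`», V#140b / V#142a (1)) | I | `N + K < 2 ^ (n / (4 * K))` (ℕ floor division) | kernel ✓ p694581 (16a `…ExactPencilSubexpCubeCount`, 512ffcb35b7ce6c3) · ✓ p694683 (16b `…ExactPencilSubexpCube`,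 62cdf20ba538f456; port-4 g4, V#149a GO / V#157c `cmp`-clean; ns `…Theorems.FifoMatching.ExactPencil.SubexpCube`) — BY NAME in `subexp_cube_of_record`; source Cruxes `ExactPencil38c` rev 1 @e32933e05cb2 = 1897d5355e5d651a (priced V#138b, KERNEL VERIFIED V#140b) | — / `ExactPencil.SubexpCube.cor_add_subexpGenCube_decided` (Theorems; = Cruxes `ExactPencilC.…` verbatim) (architecture: all labellings `Fin n → Fin K` via `Fintype.piFinset`, unread shape `ConstOn` injective in its dead set, pigeonhole over the nonempty subsets of a half) | `T c n < r` for every size-`r` EF of `COR(n) + conv(range (cubePt Q₀ G))` | `…ExactPencilSubexpCube{Count,}`; Cruxes `ExactPencil38c` (38 g4) |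
| 13 | SHORT LISTS (41 g6; V#143c): passenger lists with `(K+1)·2^{⌊h/2⌋} ≤ 3^{⌊h/2⌋}` (at most `1.5^{⌊h/2⌋}` members) — DECIDED, any shape, any budget (⊇ COLUMN-HIT's «`2K² ≤ n`» instance of row 8 and the (E-7) count floor as counts) | I | count the list: `ListFloor41.ShortList h K q` | kernel ✓ p661097 (Theorems PROP A `XcDivision.corPolytopeGraph_top_add_hull_three_pow_le`: `3^h ≤ N·(r+1)·2^h`, `N = K+1` = list length; precision V#150) — BY NAME in `short_lists_of_record`; + the two-line Cruxes corollary `ListFloor41` rev 1 @0b6e211dddc0 = 4946d4e90bde0c5b (`enemy_list_floor/_T/_real`, `three_pow_half_le`, `shortList_decided`; std axioms; nothing to port, V#143c) | top law / `ListFloor41.shortList_decided` (via `ExactPencil.T_lt_of_block_div 2`) | `3^{⌊h/2⌋} ≤ (r+1)·2^{⌊h/2⌋}` | `…XcDivisionChamberCertificate`; Cruxes `ListFloor41` |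
| E | ENGINES (not species): EDGE form + cone certificate (CLAIM α); vertex pairs with dead blocks; common maximiser; (E1) FOR CUBES = four readers (dead entries, row / column / transpose moves), residue `T(Z,β) = span{udPt (bUn β S)}` | — | `exists_commonMax_of_edgesReadD`, `…pairsReadD`; `read_of_offT` | kernel ✓ p689501 · p689680 · p690370; kernel ✓ p691147 (`cor_add_bound_of_cube_offT`); ✓ p683387 | `exactTilted_lawBody_of_edgesReadD`, `lawBody_bound_of_commonMaxD` / `cor_add_bound_of_edgesReadD`, `cor_add_bound_of_pairsReadD`, `cor_add_bound_of_commonMaxD`, `cor_add_bound_of_cube_offT`; `LocatedRows.exists_togetherFace_weight` | — | `…DeadBlocks`, `…PairsRead`, `…Window`, `…ReadCube` |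
| C | TEMPLATE CEILINGS (what ONE top cannot do; bound genus-I templates, NOT C′) | — | `not_pinExposed_of_allTriples`; `no_pure_block_of_zgen/private`; `no_exact_column_of_interDiff` | kernel ✓ p682063 · p682277 · p682946 · p688625 | — | — | `…LocatedRows.*`, `…InteractionCeiling` |
| G | 43's GENUS FUNCTORS: `Face Quiet` = «one top on a free face» AS ONE KERNEL CLASS (instances `uniqueTop`, `delLocated`, `stable`, `agree`, `twoScaleTop`, `cubeFat` ⊆ row 10 for full cubes); re-rooting `Root`, `AutWord`, `AutStar`, `Face ∘ AutStar`; `Hull`; ★ `UPat`/`UPatAt` = GENUS I OF RECORD (V#119a, clause (E-U): no UDISJ pattern of order `m₀(c,h)`); genus II = budgeted value certificates (41, row X) | I (def. of) | `Localization.Face`, `decided_face`, `decided_autStar`, `decided_hull`; (E-U) engine `uPatAt_three_pow_le`, `face_uPatF_le`, `hull_uPatF_le`, `autStar_uPat_decided` | kernel ✓ Localization parts 6–13 (p687218 · p687398 · p688217 · p689202 · p689263 · p690160 · p691158 · p691255) = the species/template lane COMPLETE at Theorems level (V#133b); (E-U) engine BY NAME in `genus_functor_of_record` | top law | `c ↦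 2c`, `h₀ ↦ h₀²` | `…Localization*` |
| G′ | PATTERN SPLIT (41 g6; `PatternSplit41.md` §2(d); crit-9 V#141a KEPT — STRUCTURAL): «genus I under budget = column compliance on almost-UDISJ(COR), passenger share ≤ (T+1)(2/3)^m; defect-tolerant KW; `UPatD` decided; smooth limit immune (Euclidean ball in kernel); STRUCTURAL, no species, no member» — caveat of record (V#141a (β)): «`UPatD` decided (kernel); genus I′ ⊇ genus I at the level of PATTERNS; whether I′ ⊋ I as a class of decided FAMILIES is not claimed (no separating passenger exhibited)»; (E-U′) = the COR-intrinsic GLOSS of (E-U), not a new clause (V#141a (α)) | I′ ⊇ I (patterns) | `PatternSplit41.UPatDF Nat.sqrt` (`uPatD_decided`); equivalence `uPatAt_iff`; defect-tolerant KW `three_pow_le_add_card_defects`; split `exists_split`; immunity `no_pattern_euclidBall` (T6) | kernel ✓ p694365 `…LocalizationPatternSplit` (A, d7b5e017eaae3dda, δ-read V#151) · ✓ p695482 `…LocalizationPatternSplitDefects` (B, tree c6cb313198e6a9b7 = GO'd 476c2a0fc5c388cd + one forced delta `dotProduct_self_nonneg'` inlined, desk #481) — BY NAME in `pattern_split_of_record`;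 source Cruxes `PatternSplit41` rev 1 @db0e975a6158 = a8d5d1a0460253ce (32 decls, std axioms; V#141a / V#146a) | top law (`decided_uPatDF`; order-`(m−1)` bound `uPatAtD_three_pow_pred_le`) | order `m−1`, floor `⌊√h⌋+1` | Cruxes `PatternSplit41`; `…LocalizationPatternSplit{,Defects}` |
| X | 41 lineage genus II: `ScPartialCommonMax ⊇ offDiagConst ⊇ diagonal`, `TwinPCM`, `TwinPCMOnTop`; ★ `TwinBlind` ⊇ π-SYMMETRIC lists (arbitrary content on a half — the first class cut out by a SYMMETRY) | II | `twinBlind_decided` &c. | kernel ✓ (`…ShadowConstRead{Generic,Pattern,Tilt p685343,Twin p686189,TwinEdge p686442,TwinPin,TwinFibre p687153,TenPinned}` landed; further pids per desk book) (port-1 `ShadowConstRead*` parts) | top law | `(3/2)^{k−2}` (twin) | `…ShadowConstRead{Generic,Pattern,Tilt,Twin,TwinEdge,TwinPin,TwinFibre}` |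

§8b THE LAW, ITS CURRENCIES, THE LINE (law-design rows)
| V | C′ ≡ COR-VIRTUAL: `exactPencilLaw_iff_corVirtualHardN`, `pinnedRowsLaw_iff_…`, `allRowsLaw_iff_…` (T1), `exactPencilLaw_iff_corVirtualHard`, `corVirtualHardN_iff_corVirtualHard` (T2), Yannakakis converse on SHARP = complete families (L1) | kernel ✓ p688316 · p688396 · p687464 | conjunct (0) of `decided_species_of_record` carries the iffs BY NAME; words of record «C′ = ExactPencilLaw = the exact-pencil form of COR-VIRTUAL; one target in two currencies» (R335) |
| P | PENCIL COLLAPSE (41 g5): `boundedExactLaw_iff (B) (hB : ∀ n, 0 < B n) : (boundedExact B).Law ↔ CorVirtualHardN`, `exactPencilLaw_iff_singletonTiltedLaw`, `boundedExactLaw_iff_exactPencilLaw` — «L♯(B) ≡ singleton-tilted(B) ≡ C′ ≡ COR-VIRTUAL for every B > 0»: L♯(B) is NOT an intermediate law (paper generality V#121a §3: every pinned clique of co-size ≥ n^{Ω(1)}) | kernel ✓ p690803 · p691192 (Theorems `…PencilCollapseFaces` / `…PencilCollapse`, ns `…Theorems.FifoMatching.PencilCollapse`, V#130b; Cruxes `PencilCollapse41`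 @74b940273780, V#120a) — BY NAME in `pencil_collapse_of_record` | ★ DESIGN RULE v3 OF RECORD (R345 (2); supersedes the R335 (2)/R343 (2) wordings): a proper intermediate located law is PENCIL-FREE at every clique of co-size ≥ n^{Ω(1)} ∧ NOT POOR (own COR-slack of super-quasi-polynomial rank₊; rows not (log n)^{O(1)}-juntas) ∧ SURVIVES `Q♮`/`Q∘`/`Q^Π_{16n}` (✓ p671347 / p674104 / p679540); the window has NO KNOWN MEMBER |
| P′ | POVERTY / JUNTA BARRIER (41 g5): `law_false_of_cheap_corSlack` (point passenger) · `law_false_of_junta` · `law_false_of_sparse_rows` · `cheapOn_argmax_class` · `no_instance_of_rich_class` | kernel (Cruxes `PovertyBarrier41` rev 2 @a57f5cfee974; V#122a/V#124a/V#126a); Theorems port kernel ✓ p692445 `…PovertyBarrier` (087f2e2de2ecf2ed, V#133a) — BY NAME in `poverty_barrier_of_record` | clause (E-9) ARGMAX-CLASS POVERTY; sig-first membership test «per member, list the rows tight at it» |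
| E4 | GENERIC VIRTUAL HARDNESS (40 g7): kernel `generic_virtual_hardness` modulo the ONE named count `PatternBoundPoly` (paper, memo §2: BPR Thm 14.16 + Prop 7.31): ∃ a, for all large n some X ⊆ {0,1}^n has no virtual EF of size ≤ 2^{n/a} in the passenger currency `VxcLe`; paper: vxc(conv X) > 2^{n/7} for all but 2^{−2^{n−1}} of X (memo: 2^{cn} for every c < 1/6); kernel form a = 16 via `growth_bound`, d = 7; and a.a. matroid base polytopes; hub equivalence (paper, memo §4) `CorVirtualHard` ⟺ some poly-size-circuit 0/1 family has vxc ≥ 2^{(log n)^{ω(1)}} | LEVEL kernel-mod-hypothesis (Cruxes `GenericVirtualHardness40` @00de8e83b2b8 = d1cb9abb640459c6 · memo `GenericVirtualHardness40.md` @47cb23445407 = b35da88ad256d072; V#141b / V#143b / V#145a; Cruxes only while `PatternBoundPoly` is open in the tree, D-0026 — never a by-name conjunct here) + paper | LAW-DESIGN/CALIBRATION row, NOT a passenger class; labels of record (R358 (3) / V#141b (iv) / V#143b): (A) FRONTIER-GRADE COUNTING CALIBRATION of `vxc` (random non-explicit 0/1 polytopes; nothing about COR or any explicit family) · (B) PLACEMENT;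 kill shape E2 / ladder ceiling E3 → `CRITIC-wave7.md` §2 (calibration of record); 0 distance |
| TC | CRUX CALIBRATION (41 g7; Cruxes `TropicalCalibration41.lean` REV 2 @47b6585f5fb9 = e5b90f1af5f4ff04 + memo @cf517611fd4d; THEOREMS ✓ p697445 `…/Negative/TropicalCalibration` + ✓ p697602 `…/Negative/TropicalCalibrationShadow`, `…Theorems.NNDivisionHardNegative.TropicalCalibration.booleanShadow_of_not_nnDivisionHard`, std axioms): NP ⊄ io-QP/poly ⇒ `NNDivisionHard` (Boolean shadow of a cheap division = i.o. quasi-poly equality test for NFPM-existence ⊇ SHUFFLE-SQUARE [BussSoltys2014]); constant-term cofactors (h(0) ≠ 0, any degree): DECIDED — a THEOREMS theorem BY NAME: `Theorems.FifoMatching.NNOrderRung.constantTerm_cofactor_hard` (`Theorems/FifoMatchingNNOrderRungOfDegreeRung.lean`; corollary at d = 0 of the ORDER TIER R2ᵒ `NNOrderRung.orderRung_of_rung`: `homogeneousComponent d h ≠ 0 → d ≤ 2^((log₂ n + k)^k) → 2^((log₂ n + c)^c) < L₊(NN_n·h)`, via `homogeneousComponent_nn_mul` (NN_n·h)^{(n+d)}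 = NN_n·h^{(d)}) applied to ✓ stmt-27271 `Theorems.FifoMatching.nnQuasiPolyLogDegreeCofactorHard_holds` (41 g8 by name); the same phenomenon polytope-side: NFP_{2n} is the (−𝟙)-face of Newt(NN·h) ⇒ xc(Newt(NN·h)) ≥ xc(NFP_{2n}) > qp (✓ stmt-26254; 42 g6 BN-g6-3(b)), and ✓ stmt-26253 at e = 0 (38 g8 BN-g8-3) — species common-extremiser/`uniqueTop` at crux level; 41's tropical route to the same tier (T2′ mSIZE(NFPM_{2n}) > qp; reading `nfpm_iff_value_eq_one_of_constTerm`) is circuit-side OPEN and NOT needed — calibration, not a rung; no status cell |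
| WA | CRUX CALIBRATION — the WINDOW-AVOIDANCE TIER (40 g9; Cruxes `WindowAvoidance40.lean` REV 1 @191f77618e6f = 504f968d46d70df7, 318 l., 1 bookkeeping def `potWeight` + 10 theorems, 0 sorry, std axioms, imports landed modules only; crit-9 g5 V#185b KEEP / V#186c KERNEL PASS on tree bytes; director R405 (3) / R407 (2)): for every c and all large n, every nonzero cofactor h ∈ ℝ≥0[x_(i,j)] having AT LEAST ONE monomial none of whose arc variables has an endpoint in SOME window of G(n,c) = 2((log₂n+c)^c+log₂n+1)^6+12 consecutive vertices satisfies 2^((log₂n+c)^c) < L₊(NN_n·h) + L₊(h) — DEGREE-FREE, ∃-MONOMIAL — DECIDED by name ★ `Summit.ValiantsHypothesis.ValiantsHypothesis.Cruxes.NNDivisionHard.WindowAvoidance40.nnDivisionHard_of_windowAvoidingMonomial` (= the BOTTOM 𝟙_W-weighted component, multiplicative and free over ℝ≥0 — `DivisionGapZeroOneTransfer.ProjClosure.botComponent_mul` / `complexity_botComponent_le`, the SIBLING crux's lever (`DivisionGapPerCofactorDegreeReductionStubBottomComponentFree`), `NN_n` being `potWeight u`-homogeneous for EVERY vertex potential (`isWeightedHomogeneous_nestFreeMatchingPoly_pot`)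 — ∘ S2a ✓ `NNLinearDegreeCofactorHard.stub_longRunInternalHard` BY NAME, whose ∀-internal hypothesis is fed by `botComponent_internal`); corollary `nnDivisionHard_of_sparseMonomial` (∃ a monomial x^d with (|V(d)|+1)·(((log₂n+c)^c+log₂n+1)^6+6) ≤ n — the ∃-monomial strengthening of ✓ `NNLowDegreeCofactorHard.nnDivisionHard_of_vertexSupport_budget`, block pigeonhole `Carve.exists_free_block`); THE RESIDUAL OF 21181 IN h-LANGUAGE, TYPED against the route decl: `nnDivisionHard_iff_windowDense : Theses.FifoMatching.NNDivisionHard ↔ (the crux for WINDOW-DENSE cofactors: every monomial meets every window)` and `nnDivisionHard_iff_denseDeepResidual : Theses.FifoMatching.NNDivisionHard ↔ (∀ k c, eventually in n: every nonzero cofactor that is WINDOW-DENSE ∧ DEEP (every homogeneous component of degree ≤ 2^((log₂n+k)^k) vanishes) passes the threshold)` (folding the ORDER tier `NNOrderRung.orderRung_of_rung` ∘ ✓ 27271 of row `TC`; the ← direction uses the diagonal k = c) — e.g. (Π_{i<n} x_(2i,2i+1))^{3^n} is residual, x_(0,1)^{3^n}·(1 + Π_v x_(v,v+1)^{3^n})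 is decided here and by NO rung of record (✓ 23918 / `nnDivisionHard_of_degree_budget` [degree]; ORDER tier ∘ ✓ 27271 incl. `constantTerm_cofactor_hard` [needs a nonzero component of degree ≤ 2^((log₂n+k)^k)]; `nnDivisionHard_of_vertexSupport_budget` [∀-monomial vertex budget]; S1 `stub_cofactorBuysVertices` / `StubTopInternalComponent` / `PrescribedInternalFace` / `KillCofactor` [∀-internal or TOP component]); «new / not new» of record (V#185b): NEW at crux level as a DECIDED membership test by name; NOT new as a mechanism (new-combination on this crux: `botComponent` had not been used on the `FifoMatching` cofactor side); EMPTY delta on C′ (after locating the gadget inside the avoided window and taking the 𝟙_W-bottom face the located passenger is a POINT) | LEVEL kernel (Cruxes; a Theorems port `Theorems/FifoMatchingNNDivisionHardWindowAvoidance.lean` is the desk's to assign at leisure, R407 (2) — imports landed modules only) | SPECIES / CRUX-CALIBRATION row (which h are hard by support shape alone), same standing as the constant-term tier of row `TC` (R405 (3) / R407 (2)); calibration, not a rung of the LINE; no status cell; 0 enemies; 0 distance on C′ ⟺ COR-VIRTUAL ⟺ `CoreLawHull` |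
| L | THE LINE OF RECORD: `Lines/virtual_passenger.lean` ★ REV 25 @80f127cbea00 (784ea0ad630c532f, 2 551 l.; written 03:47:06Z, `ledger skeleton check` OK 03:47:30Z, crit-9 g4 V#142b GO, director R359; pen 42 g4; rev 24 @63e34f5b605c = 69c65f843458d557 historical): ONE binder, sorries 1 = research stub `stub_coreLaw : CoreLawHull` (COR-VIRTUAL for budgeted, not zone-blind lists no presentation of whose hull lies in X₂₀ = X₁₉ ∨ `Localization.UPat` — `ConeD` gains the GENUS-I disjunct BY NAME ✓ p691158 / ✓ p691255, `coneD_decided`; honest label (γ) of record: «`UPat` is DECIDED ⇒ `CoreLawHull` over X₂₀ ⟺ over X₁₉ ⟺ COR-VIRTUAL ≡ C′; residual book-keeping by name, NOT progress on the law»); five currencies kernel-equivalent (`CoreLawHull` / `CoreLawFace` / `Localization.CorVirtualHard` / `LocatedRows.CorVirtualHardN` / `ExactPencilLaw`: `coreLawHull_iff_exactPencilLaw`, `coreLawFace_iff_exactPencilLaw`, `coreLawOrb_iff_exactPencilLaw`); kill chain ONE NAME `not_coreLawHull_of_not_exactPencilLaw` (rev 23c @9c16232c0fed = `CoreLawFace`,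 historical) | kernel (Cruxes) | a kernel `¬ExactPencilLaw` ⇒ `stub_coreLaw` refuted ⇒ LINE dead, crux 21181 OPEN (R335 (b′)) |
| R | `LocatedPencilLaw` (located programme v1) REFUTED | kernel ✓ p679540 | `law_chain_of_record` ✓ p682649 unchanged |

§8c (E-0)/T0 ELIMINATIONS — candidate enemies UNBUDGETED FOR CAUSE (not species: the passenger itself has no small EF, hence is INERT for C′)
| T1 | CORONA ZONE FAMILIES ⊇ the mirror pairs (incl. `Z′_cor(h)`, size-matched `Z_cor^{SM}`, every `(A ≠ ∅, B)` disjoint corona family): `xc(Q) ≥ 1.5^{⌊h/2⌋−1} − 1` (certificate = UDISJ pattern on the passenger from a sign-indefinite rank-two row) | kernel (Cruxes `TwistedFace44` @6d4ae4b3db08; V#119b/V#120b); Theorems port A ✓ p691572 `…ConePricingTwistedFaceZones` · B kernel ✓ p693246 `…ConePricingTwistedFace` (V#132) — BY NAME in `twisted_face_of_record` | currency `HasEFOfSize (convexHull …)` alone |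
| T2 | ZONOTOPE SUB-LANE CLOSED FOR THE HUNT (`ZonotopeLane44.md` @3e018b46180d, V#120b with three wording amendments): `Z_h = Σ_{|S|=s₀}[0, 𝟙_S𝟙_Sᵀ]` closed at BOTH ends (large `s₀`: row 10 `cor_add_fatColumnsCube_decided`; small: `cor_add_bound_of_cube_offT` + `FaceBlind.three_pow_le_of_shattered`) — cite-only; clique-zone lists closed in kernel (41 `cliqueZone_decided_eventually`); ZONOTOPE CLOSURE LEMMA IN KERNEL = row 12 (`ExactPencilC.cor_add_subexpGenCube_decided`, V#140b): cube passengers with `N + K(c,n) < 2^{⌊n/4K⌋}` generators decided, no hypothesis on the generators (supersedes the paper «`N ≤ 2^{n/(2K)−2}`», 38 g3 (C)(3), V#113c; few-generator form row 11); residue = GREY CLASS (saturated sign-mixed blow-ups / 𝒥-type lists `⊇ {c_L 𝟙_L𝟙_Lᵀ : |L| ≥ n/2}` with (E-0) conditionally unattainable: `h_𝒥` #P-hard via second differences, V#120b §3) | paper + kernel parts as named | no typed candidate will come from zonotopes ((P9), V#120b) |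

§8d S2 SUB-TABLE (39 lineage, REAL-λ PENCIL `M_λ`; `Literature.…HasNonnegFactorization` currency = `Calibration.nonnegRank_C3` ✓ p684578/p684617; prices nothing on the law lane)
| S2 | `rank₊ M_λ ≤ (n+1)^{4⌈2/λ⌉+1}` for every real `λ > 0` (T1) · `rank₊ M_λ ≥ 2^{Ω(min(n, λ^{−1/2}))}` for every `λ ≥ 0` (T3 `pencil_visible`, BFPS Thm 5) · conjunction degree `≥ 1/(4λ)` needed (T2) · ROW-SYMMETRIC certificates: `n^{Θ(min(n,1/λ))}`, visible iff `λ → 0` (T4 `pencil_symm_lower`; CLRS L4.2 / Dixon–Mortimer + T2) — window `[c/log² n, o(1)]` open for ASYMMETRIC slots only | kernel (Cruxes `RealLambda39` rev 6 @bd25df79f90f = 7f279fd523d61682; T4 KERNEL VERIFIED V#122b, `pencil_symm_lower` std; S2 LANE COMPLETE T1–T4) → RealLambda39 → THEOREMS 6/6 (✓ p691577 · p691951 · p695029 · p695512 · p695958 · p695984; V#159b) `Theorems/NNDivisionHard/Negative/RealLambda{Cone,Blind,Pencil,Lower,Visible,Symmetric}.lean` (ns `…Theorems.NNDivisionHardNegative.RealLambda`;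 port-2 g4; `declsig` 119/119 verbatim vs `RealLambda39` rev 6; T1–T4 = THEOREMS by name) | text endorsed V#118a; LEVEL annotation V#170 |
| S2′ | ASYMMETRIC-WINDOW INSTRUMENTS (39 g6): S2-K1 «λ = 0 slice endpoint: any nonneg factorisation of ((1−|a∩b|)²) on the rows |a| = k has C(n,k) ≤ |S|·2^k slots (`AsymmetricWindow39.choose_le_card_mul_two_pow_of_slice_block`, `pencil_zero_slice_lower`); support genus (sliced Kaibel–Weltge); rank ≤ 1+n+C(n,2)» · S2-K2 «monotone in λ: λ′ ≤ λ ⇒ rank₊ M_λ ≤ rank₊ M_λ′ + n² (`pencilEntry_factorization_mono'`, `pencilEntry_lower_downward`); lower bounds transfer downward in λ, certificates upward; visibility threshold λ*(n) well-defined up to n²» · S2-K3 «located neighbourhood: #{a : |a| = k, inv(a;π) ≤ w} ≤ ((w+1)^{√w})², independent of n (`card_informative_rows_le`; structure `informative_row_structure`: j elements of the upper w-window swapped for j of the lower w-window, j² ≤ w)» · S2-LL (CONJECTURE row, memo `AsymmetricWindow39.md`; never a stub): located lifting for the PENCIL slice — OPEN; pointer of record (R1, memo rev 4 @a72bc4822192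 §2′; V#157a / R376 (1)(γ)): LL-1 ⇐ LL-1(M̄_{λ,k}) — ★ rev 13.7 (R395 (2); crit-9 g4 V#180b (a)–(c) / crit-9 g5 V#184a): the pointer is TRUE but VOID — **LL-1(M̄_{λ,k}) «rank₊ M̄_{λ,k} ≥ n^{c·min(k,1/λ)}» is FALSE: ONE BLOCK IS EASY** (39 g7 THEOREM A, kernel Cruxes `SingleBlock39.lean` rev 1 @a4c4c4447d28 = 25f39ee6d8a34698, 898 l., 0 sorry, std axioms; ★ `SingleBlock39.pencilBar_hasNonnegFactorization (n k h) (hlam : 0 < lam) (hh : 1 ≤ lam*(h+1)) : HasNonnegFactorization (pencilBarSlice n lam k) (2n²+n+1+(k+1)·2^{h(h+2)})` + `_ceil` (h = ⌈1/λ⌉₊−1) — an EXPLICIT nonnegative factorisation (`rowF`/`colF` over `Slot n k L`; 2n²+n+1 universal columns `1`, `(1−|B∩[i,j]|)²`, `[p,q∈B]`, `[p∉B]` for the regular rows + ≤ (k+1)·2^{h(h+2)} private columns `Y(LOW,·)` for the irregular LOW-patterns `[0,m) ⊔ (m+1+Q)`), `pencilBar` byte-verbatim = AW39 §5 = the block π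 = id of the k-slice by `pencil_block_one`; LEVEL: kernel (the bound) / paper (the two-line negation: ∀ c > 0 fix k ≥ 3/c and λ ≤ c/3 (so c·min(k,1/λ) ≥ 3), h = ⌈1/λ⌉−1, then rank₊ M̄^{(n)}_{λ,k} ≤ 2n²+n+1+(k+1)·2^{h(h+2)} < n³ ≤ n^{c·min(k,1/λ)} for n large; n-exponent of one block = 2 exactly, lower C(n,2) from the pair coefficients, paper; the n-free term is NECESSARY — rank₊ M̄_{λ,k} ≥ 2^{Ω(min(k, n−k, λ^{−1/2}))} (★★ `SingleBlock39.singleBlock_visible`, REV 2 @d9b2c862ee4b: one block contains the ρ-extension of UDISJ_m, BFPS 2012 Thm 5 as discharged in `UdisjShiftNonnegativeRank`), so one block = Θ(n²) + an n-free term in [2^{Ω(√h)}, (k+1)·2^{h(h+2)}], h ≍ 1/λ, power of h open)); CONSEQUENCES of record: (b) memo R3 «coverage accounting — located exactness is worthless» HEURISTIC STRUCK (39 g7's memo `AsymmetricWindow39.md` rev 5 carries the strike; rev 4 @a72bc4822192 §2′ R3 is superseded on this point); (c) the S2 window for the PENCIL `M_λ|_k` (the S_n-unfolding of M̄, `pencil_quotient`)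 is a pure S_n-GLUING question — covariant gluing costs n^{Θ(min(n,1/λ))} (T4 `pencil_symm_lower`/`_upper`), general gluing OPEN in [max(C(n,2), T3), (n+1)^{O(1/λ)}]; twin in print [Kaibel–Pashkovich–Theis 2010, arXiv:0911.1628] (symmetry costs in extended formulations); S2-lane NEGATIVE-SIDE equipment, 0 distance on C′ / 21181 | kernel (Cruxes `AsymmetricWindow39` rev 1 @4f29a1b2abda = 404e3fcf456bdce2, KERNEL OF RECORD V#139a, axioms std) → Theorems `NNDivisionHard/Negative/AsymmetricWindow{Slice,Informative}` (port-1 g4, CONTENT GO V#140a: part 1 ✓ p693237 `…AsymmetricWindowSlice` · part 2 ✓ p695032 `…AsymmetricWindowInformative`; §4 = parts 3–4 ✓ p695658 `…AsymmetricWindowHashCap` / ✓ p696383 `…AsymmetricWindowHashCarrier`, rows S2-K4′/S2-K5 — AW39 §1–§4 → THEOREMS 4/4; S2 KERNEL OF RECORD = REV 4 @1064d0978540 = a69020e115a2f101 (§1–§4 byte-identical; + §5 Quotient `pencil_quotient` = R1, `pencilBar_factorization_of_pencil`; V#159a / R376 (2); memo rev 4 @a72bc4822192)) | text endorsed V#139a;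 annotations R376 (1) |
| S2-K4′ | CLASS D (located disjointness-pattern hyperplane witnesses on a slice: zero off `inv ≤ w`, `≥ 0` on near `|a∩b| ≠ 1`) is CAPPED by one hash rectangle `{Σ_{x∈a} ω(x) ≡ c₀ (mod q)} × {columns with no hit near level-1 row}`: `B_W ≤ 2q·M⁺/min(1, λ(w+1))`, `q = 2((w+1)^{√w})²` — no `n^{f(λ)}`; T2/T3 ∈ CLASS D ⇒ T3's `2^{Ω(λ^{-1/2})}` optimal in genus up to log; any-sign near-supported witnesses: see S2-K5 | kernel (S2 KERNEL OF RECORD = Cruxes `AsymmetricWindow39` REV 4 @1064d0978540 = a69020e115a2f101, R376 (2) / V#159a — §1–§4 byte-identical to REV 3 @e78aa2176e1c; PROP H `located_disjointness_witness_cap` + `witness_value_le`, abstract `hash_rectangle_cap` entered at REV 2 @25e40f3bb6b0; V#140c / V#143a (δ) / V#145b) · THEOREMS ✓ p695658 `…/Negative/AsymmetricWindowHashCap` (d555936c7e7d47af; `…Theorems.NNDivisionHardNegative.AsymmetricWindow.hash_rectangle_cap` / `located_disjointness_witness_cap`; δ-read V#160b) — AW39 §1–§4 → THEOREMS 4/4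 (✓ p693237 · ✓ p695032 · ✓ p695658 · ✓ p696383; R376 (1)) | STATUS: DECIDED (cap), kernel |
| S2-K5 | EVERY hyperplane witness supported on the near entries (`inv ≤ w`) of a slice — any sign pattern — is capped: `s·⟨W,M_λ⟩ ≤ 4q(n+1)²·⟨W,uvᵀ⟩` for a feasible rectangle (hashed unit carrier or hashed inversion carrier `λ[l∈a][l′∉a]⊗[π(l′)<π(l)]`), `q = 2((w+1)^{√w})²`, `s = min(1, λ(w+1))`: located certificates of hardness are T3-strength, `poly(n)·2^{O(λ^{-1/2} log(1/λ))}`, and no more; and a witness merely NONNEGATIVE off the near entries is capped likewise (H″ `farNonneg_witness_cap`, REV 3 @e78aa2176e1c): an `n^{f(λ)}` hyperplane bound REQUIRES NEGATIVE FAR MASS | kernel (S2 KERNEL OF RECORD = Cruxes `AsymmetricWindow39` REV 4 @1064d0978540 = a69020e115a2f101, R376 (2) / V#159a — §1–§4 byte-identical to REV 3; PROP H′ `located_witness_cap`, engine `hash_carrier_cap`, bookkeeping `cap_combine` entered at REV 2 @25e40f3bb6b0 — wording ENDORSED VERBATIM V#143a (δ); PROP H″ `farNonneg_witness_cap` at REV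 3 @e78aa2176e1c = 7e4b5ff93693dde0 (1226 l.; + PROP H″ `farNonneg_witness_cap`; GO V#147a, δ-read V#148a = S2 KERNEL OF RECORD) — closing clause V#147a (i)) · THEOREMS ✓ p696383 `…/Negative/AsymmetricWindowHashCarrier` (b879173bece2ca76; `…AsymmetricWindow.hash_carrier_cap` / `farNonneg_witness_cap` / `located_witness_cap`; δ-read V#160b) | STATUS: DECIDED (no-go), kernel |
| S2-LL½ | rev-1 conjecture «located hyperplane lifting `n^{cλ^{-1/2}}`» (near-supported) | DEAD by S2-K5 (kernel no-go H′; settled negative of the S2 lane, V#143a (β)) | STATUS: DEAD |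
| S2-N | CONJECTURE N: the full rectangle LP `ν(M_λ|_k)` is T3-strength | CONJECTURE row, never a stub (V#143a (γ)); its one experiment (far-negative witness moves the S2-LP optimum when mid-range flood rows are opened) NOT COMMISSIONED (R360 (2)(a); kit 0) | STATUS: OPEN (conjecture) |

§8e ENEMY SPECIFICATION — BY POINTER (R339: the clauses moved several times in one night; the record is the critic's running §2, not a reprint here):
`Cruxes/NNDivisionHard/CRITIC-wave7.md` §2 «Law / enemy status (running)» = V#98 base (E-0) budget · (E-1) 38's EDGE form · (E-2) 41's twin/pin form · (E-3) 43's
per-rooting clause · (E-4) template ceilings bound genus-I templates only; amendments V#101b/V#103 (E-1″) window closed from above in every rooting, `K(c,n) = 2(log₂n+c)^c+6` ·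
(E-2′) not π-symmetric / twin-PCM for any near-perfect twin pairing · (E-3′) outside `Face (AutStar (ConeD))`; V#113 (E-5‴) for EVERY `ι` with `|ι| ≥ K(c,n)` a nonzero
SYMMETRIC generator inside `ι×ι` and for every located pair with `≥ K(c,n)` live blocks a nonzero generator in `T(Z,β)` (kernel for cubes: rows 10/11/12/E; generator-count footnote floor of record «`N ≥ 2^{⌊n/(4K)⌋} − K`», row 12, V#140b / V#142a (1)); and the clauses
admitted since V#121: (E-U) NO UDISJ pattern of order `m₀(c,h)` (V#119a; GENUS I = `UPat`, 43 rev 5) · (E-7) TWIN–FAT FIBRES (V#125a; THEOREMS ✓ p692595 `Theorems/FifoMatchingNNDivisionHardLocalizationFatTwins.lean` at threshold `log₂log₂ℓ` incl.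
the vertex-count floor (`…Theorems.FifoMatching.FatTwins.enemy_fatTwins` / `enemy_many_members` / `sparseTwinTop_decided`, δ-read V#138a; source Cruxes `FatTwins44` rev 2 @bc27b586dc48, V#128b/V#129b); the `ℓ/K` strength paper via ✓ p690370; (E-7) COUNT FLOOR OF RECORD (V#143c) := «an enemy list / passenger polytope has `N ≥ 1.5^h/(T c h + 1)` members (vertices)» — THEOREMS BY NAME ✓ p661097, row 13 — the STRUCTURAL SIEVE (twin–fat fibres) stands as the clause) · (E-8) THICKNESS (V#125a; paper =
`corSandwichXC_quasipoly` + translation) · (E-9) ARGMAX-CLASS POVERTY (V#126a; kernel `cheapOn_argmax_class`, row P′) · (E-H) HEREDITY `xc(COR(n−1) + π F_Q) ≤ xc(COR(n) + Q)`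
for every diagonal top face (V#121).  WHO FAILS IT (kernel, by name): rows 1–13, G, G′, X above.  R-MEMBERS (V#119a: a budget passenger whose sum `COR(K_h) + Q` carries NO
UDISJ pattern of order `m₀(c,h)` — the first object on which C′ provably needs a non-support certificate; NOT an enemy): 0 known.  ENEMIES (typed `¬ExactPencilLaw`
candidates): 0.  Lane (b) (44 g1) W7 HUNT REPORT COMPLETE (V#125a, R346 (1)): zonotopes closed for the hunt (§8c T2), non-zonotope families FOUND-NOTHING
(`NonZonotope44.md` @9a54a4db5d66), (P9) NO typed candidate; 0 enemies / 0 R-members / 0 candidates at sig-first.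

HONEST LABEL: every kernel row is a DECIDED SPECIES, an engine, a ceiling, a currency equivalence or a T0 elimination; the law C′ = `LocatedRows.ExactPencilLaw`
≡ COR-VIRTUAL ≡ `CoreLawFace` is OPEN; `LocatedPencilLaw` is REFUTED; the crux 21181 `NNDivisionHard` is OPEN; 0 R-members, 0 enemies known;
VP ≠ VNP is NOT proved here or anywhere in this tree.
-/

set_option autoImplicit false

-- the mandated summit-side namespace repeats a component by design (single-problem summit)
set_option linter.dupNamespace false

noncomputable section

namespace Summit.ValiantsHypothesis.ValiantsHypothesis.Cruxes.NNDivisionHard.ValIdea40Census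

open Matrix Finset
open scoped Pointwise
open Literature.Barriers.PneNP (HasEFOfSize)
open Literature.Combinatorics.Optimization.FixedSizePsdRank (corPolytope)
open Summit.ValiantsHypothesis.ValiantsHypothesis.Theorems.FifoMatching
open Summit.ValiantsHypothesis.ValiantsHypothesis.Theorems.FifoMatching.XcDivision (udRow udPt)
open Summit.ValiantsHypothesis.Theorems.NNDivisionHardNegative.DiagTilted (qOff)

/-- the BODY of a row-family law at `(c, n, K, q, r)` — «a size-`r` extended formulation of the passenger and a nonnegative factorisation
through `r` slots of the exact `F`-row slack matrix of `COR(n) + conv q` force `T c n < r`»; `F.Law` is literally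
`∀ c, ∃ n₀, ∀ n ≥ n₀, ∀ K q r, LawBodyAt F c n K q r` (`law_iff_lawBodyAt`, by `Iff.rfl`). -/
def LawBodyAt (F : LocatedRows.RowFamily) (c n K : ℕ) (q : Fin (K + 1) → (Fin (n * n) → ℝ)) (r : ℕ) : Prop :=
  HasEFOfSize (convexHull ℝ (Set.range q)) r →
    ∀ m : F.A n → ℝ, (∀ a j, F.ρ n a ⬝ᵥ q j ≤ m a) → (∀ a, ∃ j, F.ρ n a ⬝ᵥ q j = m a) →
    ∀ (U : F.A n → Option (Fin r) → ℝ) (V : Finset (Fin n) × Fin (K + 1) → Option (Fin r) → ℝ),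
      (∀ a i, 0 ≤ U a i) → (∀ p i, 0 ≤ V p i) →
      (∀ a b j, (F.β n a + m a) - F.ρ n a ⬝ᵥ (udPt b + q j) = ∑ i, U a i * V (b, j) i) → LocatedRows.T c n < r

/-- `F.Law` is its body, eventually in `n`, for every passenger (definitional). -/
theorem law_iff_lawBodyAt (F : LocatedRows.RowFamily) :
    F.Law ↔ ∀ c : ℕ, ∃ n₀ : ℕ, ∀ n ≥ n₀, ∀ (K : ℕ) (q : Fin (K + 1) → (Fin (n * n) → ℝ)) (r : ℕ), LawBodyAt F c n K q r :=
  Iff.rfl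

/-- TOP-LAW currency at `(c, n, K, q, r)`: «every size-`r` extended formulation of `COR(n) + conv q` has `T c n < r`» (the conclusion of
COR-VIRTUAL without its passenger-budget hypothesis). -/
def TopDecidedAt (c n K : ℕ) (q : Fin (K + 1) → (Fin (n * n) → ℝ)) (r : ℕ) : Prop :=
  HasEFOfSize (corPolytope n + convexHull ℝ (Set.range q)) r → LocatedRows.T c n < r

/-- top-law decidedness discharges the COR-VIRTUAL body at that passenger (the budget hypothesis is simply dropped). -/
theorem corVirtual_body_of_topDecidedAt {c n K : ℕ} {q : Fin (K + 1) → (Fin (n * n) → ℝ)} {r : ℕ} (h : TopDecidedAt c n K q r) :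
    HasEFOfSize (corPolytope n + convexHull ℝ (Set.range q)) r → HasEFOfSize (convexHull ℝ (Set.range q)) r → LocatedRows.T c n < r :=
  fun hR _ => h hR

/-- ★ **THE C′ CENSUS OF RECORD (rev 12), BY NAME.**  Conjuncts, in order: (0) the law chain with its dead bottom rung
(`law_chain_of_record`, ✓ p682649); (1) PIN-EXPOSED passengers — C′ law body and top law (✓ p681115 / p681292); (1a) the zero-diagonal cube of
record `Q∘` is pin-exposed (`n ≥ 4`) and column-coupled, and the C′ law body holds on it (✓ p680583 / p681115 / p681523); (1b) the diagonal
permutahedron is pin-exposed, law body and top law (✓ p681523); (2) COLUMN-COUPLED affine cubes — law body and top law (✓ p681292).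
Every conjunct is the landed theorem named in the table above, applied verbatim (`LawBodyAt` / `TopDecidedAt` unfold to their statements). -/
theorem decided_species_of_record :
    -- (0) the law chain of record
    (¬ LocatedRows.LocatedPencilLaw ∧ (LocatedRows.pinnedRows.Law → LocatedRows.ExactPencilLaw) ∧
      (LocatedRows.ExactPencilLaw → LocatedRows.allRows.Law) ∧ (LocatedRows.allRows.Law → LocatedRows.CorVirtualHardN)) ∧
    -- (1) pin-exposed passengers: law body, top law
    (∀ c : ℕ, ∃ n₀ : ℕ, ∀ n ≥ n₀, ∀ (K : ℕ) (q : Fin (K + 1) → (Fin (n * n) → ℝ)) (r : ℕ),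
      LocatedRows.PinExposed n K q → LawBodyAt LocatedRows.exactTilted c n K q r) ∧
    (∀ c : ℕ, ∃ n₀ : ℕ, ∀ n ≥ n₀, ∀ (K : ℕ) (q : Fin (K + 1) → (Fin (n * n) → ℝ)) (r : ℕ),
      LocatedRows.PinExposed n K q → TopDecidedAt c n K q r) ∧
    -- (1a) the zero-diagonal cube of record
    (∀ n : ℕ, 4 ≤ n → ∀ i m : Fin n, i ≠ m → ∀ (K : ℕ) (e : Fin (K + 1) ≃ Finset (Fin n)), LocatedRows.PinExposed n K (qOff ∘ e)) ∧
    (∀ n : ℕ, 2 ≤ n → ∀ x x' : Fin n, x' ≠ x → LocatedRows.ColumnCoupled (LocatedRows.qOffGen n)) ∧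
    (∀ c : ℕ, ∃ n₀ : ℕ, ∀ n ≥ n₀, ∀ (K : ℕ) (e : Fin (K + 1) ≃ Finset (Fin n)) (r : ℕ),
      LawBodyAt LocatedRows.exactTilted c n K (qOff ∘ e) r) ∧
    -- (1b) the diagonal permutahedron
    (∀ n : ℕ, 2 ≤ n → ∀ s₀ : Fin n, (s₀ : ℕ) = n - 1 → ∀ lam : ℝ, 0 ≤ lam → ∀ (K : ℕ) (e : Fin (K + 1) → Equiv.Perm (Fin n))
      (jstar : Fin (K + 1)), e jstar = Fin.revPerm → LocatedRows.PinExposed n K (LocatedRows.qPerm n lam ∘ e)) ∧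
    (∀ c : ℕ, ∃ n₀ : ℕ, ∀ n ≥ n₀, ∀ (K : ℕ) (lam : ℝ) (e : Fin (K + 1) → Equiv.Perm (Fin n)) (r : ℕ), 0 ≤ lam →
      (∃ j, e j = Fin.revPerm) → LawBodyAt LocatedRows.exactTilted c n K (LocatedRows.qPerm n lam ∘ e) r) ∧
    (∀ c : ℕ, ∃ n₀ : ℕ, ∀ n ≥ n₀, ∀ (K : ℕ) (lam : ℝ) (e : Fin (K + 1) → Equiv.Perm (Fin n)) (r : ℕ), 0 ≤ lam →
      (∃ j, e j = Fin.revPerm) → TopDecidedAt c n K (LocatedRows.qPerm n lam ∘ e) r) ∧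
    -- (2) column-coupled affine cubes: law body, top law
    (∀ c : ℕ, ∃ n₀ : ℕ, ∀ n ≥ n₀, ∀ (N K : ℕ) (Q₀ : Matrix (Fin n) (Fin n) ℝ) (G : Fin N → Matrix (Fin n) (Fin n) ℝ)
      (e : Fin (K + 1) → Finset (Fin N)) (r : ℕ), Function.Surjective e → LocatedRows.ColumnCoupled G →
      LawBodyAt LocatedRows.exactTilted c n K (LocatedRows.cubePt Q₀ G ∘ e) r) ∧
    (∀ c : ℕ, ∃ n₀ : ℕ, ∀ n ≥ n₀, ∀ (N K : ℕ) (Q₀ : Matrix (Fin n) (Fin n) ℝ) (G : Fin N → Matrix (Fin n) (Fin n) ℝ)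
      (e : Fin (K + 1) → Finset (Fin N)) (r : ℕ), Function.Surjective e → LocatedRows.ColumnCoupled G →
      TopDecidedAt c n K (LocatedRows.cubePt Q₀ G ∘ e) r) :=
  ⟨Summit.ValiantsHypothesis.Theorems.NNDivisionHardNegative.LocatedRows.law_chain_of_record,
   LocatedRows.exactTilted_law_on_pinExposed, LocatedRows.pinExposed_decided,
   fun _ hn _ _ him _ e => LocatedRows.pinExposed_qOff hn him e,
   fun _ hn _ _ hx => LocatedRows.columnCoupled_qOff hn hx,
   LocatedRows.exactTilted_law_holds_on_qOff,
   fun _ hn s₀ hs _ hlam _ e jstar hj => LocatedRows.pinExposed_qPerm hn s₀ hs hlam e jstar hj,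
   LocatedRows.exactTilted_law_holds_on_qPerm, LocatedRows.qPerm_decided,
   LocatedRows.exactTilted_law_on_columnCoupled, LocatedRows.columnCoupled_decided⟩




/-- «the statement of the theorem `h`» — lets the census cite a landed theorem BY NAME without restating it: `StatementOf @X` is
definitionally the fully explicit statement of `X` (`statementOf_iff`), and `X` itself proves it. -/
abbrev StatementOf {p : Prop} (_h : p) : Prop := p

theorem statementOf_iff {p : Prop} (h : p) : StatementOf h ↔ p := Iff.rfl

open Summit.ValiantsHypothesis.ValiantsHypothesis.Theorems.FifoMatching in
/-- ★ **THE C′ CENSUS OF RECORD — val-idea-38's species rows 3–9, the engines E and the transversal ceiling C, BY NAME** (rev 13).  BOOKKEEPING BY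
NAME (crit-9 g3 V#105b): conjunct `k` := THE TYPE of the `k`-th landed constant `…Theorems.FifoMatching.ExactPencil.<decl>` (`StatementOf @<decl>`;
unfold with `statementOf_iff` / `show <statement>` to read it), proved by that constant — the theorem's whole content is «these 21 names resolve to
sorry-free `Theorems/` constants» (`#print axioms` = std); the informative part is the CENSUS TABLE above (genus / test / LEVEL / proof route / rate).
Order: (3) pair cube — C′ law, top law; (4) zero-diagonal / scaled generator cubes — C′ law, top law ×2; (5) sparse-generator cubes — top law at fixed `s`,
and in the WINDOW `s·(2(log₂ n + c)^c + 6) ≤ n` for every `n` (R334 (2) prover half); (6) sparse differences — fixed `s`, window; (7) touch-Z-or-sparse;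
(8) column-hit / few-vertex / CUT; (9) function graphs — top law, C′ law body; (E) engines — edge form (top law, C′ law body), pairs-read with dead blocks,
common maximiser (top law, C′ law body); (C) transversal template ceiling.  LEVEL note (crit-9 V#100 (c′), pending ruling): «C′ law body» vs «top law»
is a PROOF-ROUTE distinction (exact-pencil maxima vs direct slack), both = COR-VIRTUAL decided on the species once `ExactPencilLaw ↔ CorVirtualHardN` is kernel. -/
theorem exactPencil_species_of_record :
    -- (3) the pair cube
    StatementOf @ExactPencil.exactTilted_law_holds_on_qPair ∧ StatementOf @ExactPencil.cor_add_qPair_decided ∧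
    -- (4) zero-diagonal difference cubes, scaled
    StatementOf @ExactPencil.exactTilted_law_holds_on_zgenCube ∧ StatementOf @ExactPencil.cor_add_zgenCube_decided ∧ StatementOf @ExactPencil.cor_add_scaledZgenCube_decided ∧
    -- (5) sparse-generator cubes: fixed `s`, and the window `s = n / (2(log₂ n + c)^c + 6)` (every `n`)
    StatementOf @ExactPencil.cor_add_sparseCube_decided ∧ StatementOf @ExactPencil.cor_add_sparseCube_decided_window ∧
    -- (6) sparse-difference passengers: fixed `s`, and the window
    StatementOf @ExactPencil.cor_add_sparseDiff_decided ∧ StatementOf @ExactPencil.cor_add_sparseDiff_decided_window ∧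
    -- (7) touch-Z-or-sparse
    StatementOf @ExactPencil.cor_add_touchOrSparse_decided ∧
    -- (8) column-hit, few-vertex (`2K² ≤ n`), `COR(n) + CUT(n)`
    StatementOf @ExactPencil.cor_add_columnHit_decided ∧ StatementOf @ExactPencil.cor_add_fewVertex_decided ∧ StatementOf @ExactPencil.cor_add_cut_bound ∧
    -- (9) function graphs: top law, C′ law body
    StatementOf @ExactPencil.cor_add_funcGraph_decided ∧ StatementOf @ExactPencil.exactTilted_lawBody_funcGraph ∧
    -- (E) engines: EDGE form (cone certificate) top law + C′ law body; vertex pairs with dead blocks; common maximiser top law + C′ law body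
    StatementOf @ExactPencil.cor_add_bound_of_edgesReadD ∧ StatementOf @ExactPencil.exactTilted_lawBody_of_edgesReadD ∧ StatementOf @ExactPencil.cor_add_bound_of_pairsReadD ∧ StatementOf @ExactPencil.cor_add_bound_of_commonMaxD ∧ StatementOf @ExactPencil.lawBody_bound_of_commonMaxD ∧
    -- (C) the transversal template ceiling
    StatementOf @ExactPencil.no_exact_column_of_interDiff :=
  ⟨@ExactPencil.exactTilted_law_holds_on_qPair, @ExactPencil.cor_add_qPair_decided, @ExactPencil.exactTilted_law_holds_on_zgenCube,
   @ExactPencil.cor_add_zgenCube_decided, @ExactPencil.cor_add_scaledZgenCube_decided, @ExactPencil.cor_add_sparseCube_decided,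
   @ExactPencil.cor_add_sparseCube_decided_window, @ExactPencil.cor_add_sparseDiff_decided, @ExactPencil.cor_add_sparseDiff_decided_window,
   @ExactPencil.cor_add_touchOrSparse_decided, @ExactPencil.cor_add_columnHit_decided, @ExactPencil.cor_add_fewVertex_decided,
   @ExactPencil.cor_add_cut_bound, @ExactPencil.cor_add_funcGraph_decided, @ExactPencil.exactTilted_lawBody_funcGraph,
   @ExactPencil.cor_add_bound_of_edgesReadD, @ExactPencil.exactTilted_lawBody_of_edgesReadD, @ExactPencil.cor_add_bound_of_pairsReadD,
   @ExactPencil.cor_add_bound_of_commonMaxD, @ExactPencil.lawBody_bound_of_commonMaxD, @ExactPencil.no_exact_column_of_interDiff⟩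


/-- ROW V of the census (rev 13): C′ ≡ COR-VIRTUAL IN THEOREMS, by name — T1 ✓ p688316 `…ExactIsVirtual.exactPencilLaw_iff_corVirtualHardN`
(+ `pinnedRowsLaw_iff_…`, `allRowsLaw_iff_…`), T2 ✓ p688396 `…corVirtualHardN_iff_corVirtualHard`, `…exactPencilLaw_iff_corVirtualHard`
(val-idea-41 g4; L1 ✓ p687464 Yannakakis converse).  Words of record (R335): «C′ = ExactPencilLaw = the exact-pencil form of COR-VIRTUAL; one
target in two currencies» — so «law body / top law» in the table is a PROOF-ROUTE column, not a level. -/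
theorem currencies_of_record :
    StatementOf @ExactIsVirtual.exactPencilLaw_iff_corVirtualHardN ∧ StatementOf @ExactIsVirtual.pinnedRowsLaw_iff_corVirtualHardN ∧
    StatementOf @ExactIsVirtual.allRowsLaw_iff_corVirtualHardN ∧ StatementOf @ExactIsVirtual.corVirtualHardN_iff_corVirtualHard ∧
    StatementOf @ExactIsVirtual.exactPencilLaw_iff_corVirtualHard :=
  ⟨@ExactIsVirtual.exactPencilLaw_iff_corVirtualHardN, @ExactIsVirtual.pinnedRowsLaw_iff_corVirtualHardN,
   @ExactIsVirtual.allRowsLaw_iff_corVirtualHardN, @ExactIsVirtual.corVirtualHardN_iff_corVirtualHard,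
   @ExactIsVirtual.exactPencilLaw_iff_corVirtualHard⟩

/-- sanity (rev 13): the first conjunct of `currencies_of_record` IS `LocatedRows.ExactPencilLaw ↔ LocatedRows.CorVirtualHardN`. -/
example : StatementOf @ExactIsVirtual.exactPencilLaw_iff_corVirtualHardN ↔ (LocatedRows.ExactPencilLaw ↔ LocatedRows.CorVirtualHardN) := Iff.rfl


/-- ROWS 10 (+ engine E cube instance) of the census (rev 13): val-idea-38 g3's STICK-OUT / FAT CUBES AT POLYLOG SCALE, by name from the landed port parts 14/15
`…Theorems.FifoMatchingNNDivisionHardExactPencilStickOut` / `…ReadCube` (crit-9 V#113 / V#116b / V#116c; row 11 and (E1)-for-cubes). -/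
theorem exactPencil_cube_species_of_record :
    StatementOf @ExactPencil.cor_add_bound_of_stickOutCube ∧ StatementOf @ExactPencil.exactTilted_lawBody_stickOutCube ∧
    StatementOf @ExactPencil.cor_add_stickOutCube_decided ∧ StatementOf @ExactPencil.cor_add_fatCube_decided ∧
    StatementOf @ExactPencil.cor_add_fatColumnsCube_decided ∧ StatementOf @ExactPencil.cor_add_fatRowsCube_decided ∧
    StatementOf @ExactPencil.cor_add_bound_of_cube_offT ∧ StatementOf @ExactPencil.cor_add_fewGenCube_decided :=
  ⟨@ExactPencil.cor_add_bound_of_stickOutCube, @ExactPencil.exactTilted_lawBody_stickOutCube, @ExactPencil.cor_add_stickOutCube_decided,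
   @ExactPencil.cor_add_fatCube_decided, @ExactPencil.cor_add_fatColumnsCube_decided, @ExactPencil.cor_add_fatRowsCube_decided,
   @ExactPencil.cor_add_bound_of_cube_offT, @ExactPencil.cor_add_fewGenCube_decided⟩

/-- ROW P of the census (rev 13.1): val-idea-41 g5's PENCIL COLLAPSE in THEOREMS, by name (port ✓ p690803 `…PencilCollapseFaces` · ✓ p691192 `…PencilCollapse`;
crit-9 V#117b / V#120a / V#130b): «L♯(B) ≡ singleton-tilted(B) ≡ C′ ≡ COR-VIRTUAL for every B > 0» — the bounded-tilt exact law is NOT an intermediate law;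
DESIGN RULE v3 (R345 (2)) clause (a) PENCIL-FREE reads these. -/
theorem pencil_collapse_of_record :
    StatementOf @PencilCollapse.boundedExactLaw_iff ∧ StatementOf @PencilCollapse.boundedExactLaw_iff_exactPencilLaw ∧
    StatementOf @PencilCollapse.singletonTiltedLaw_iff ∧ StatementOf @PencilCollapse.exactPencilLaw_iff_singletonTiltedLaw ∧
    StatementOf @PencilCollapse.law_of_corVirtualHardN_of_pencil :=
  ⟨@PencilCollapse.boundedExactLaw_iff, @PencilCollapse.boundedExactLaw_iff_exactPencilLaw, @PencilCollapse.singletonTiltedLaw_iff,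
   @PencilCollapse.exactPencilLaw_iff_singletonTiltedLaw, @PencilCollapse.law_of_corVirtualHardN_of_pencil⟩

/-- ROW G of the census (rev 13.1): val-idea-43's GENUS-I engine (E-U) in THEOREMS, by name (Localization parts 12 ✓ p691158 `…LocalizationUPat` ·
13 ✓ p691255 `…LocalizationUPatFace`; crit-9 V#119a GENUS I = `UPat` of record, V#131b / V#133b): no UDISJ pattern of order `m` ⟹ `3^m ≤ (r+1)·2^m`;
`Face`/`Hull` of `UPatF` collapse to `UPatF`; `AutStar UPat` decided. -/
theorem genus_functor_of_record :
    StatementOf @Localization.uPatAt_three_pow_le ∧ StatementOf @Localization.face_uPatF_le ∧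
    StatementOf @Localization.hull_uPatF_le ∧ StatementOf @Localization.autStar_uPat_decided :=
  ⟨@Localization.uPatAt_three_pow_le, @Localization.face_uPatF_le, @Localization.hull_uPatF_le, @Localization.autStar_uPat_decided⟩


/-- ROW P′ of the census (rev 13.2): val-idea-41 g5's POVERTY / JUNTA BARRIER in THEOREMS, by name (port kernel ✓ p692445 `…Theorems.FifoMatching.PovertyBarrier`,
source Cruxes `PovertyBarrier41` rev 2 @a57f5cfee974; crit-9 V#122a / V#124a / V#126a / V#133a): a row family whose COR-slack is cheap (junta / sparse rows /
argmax-own-block classes) has NO instance of the law — DESIGN RULE v3 clause (b) NOT POOR reads these. -/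
theorem poverty_barrier_of_record :
    StatementOf @PovertyBarrier.law_false_of_cheap_corSlack ∧ StatementOf @PovertyBarrier.law_false_of_junta ∧
    StatementOf @PovertyBarrier.law_false_of_sparse_rows ∧ StatementOf @PovertyBarrier.cheapOn_argmax_class ∧
    StatementOf @PovertyBarrier.no_instance_of_rich_class :=
  ⟨@PovertyBarrier.law_false_of_cheap_corSlack, @PovertyBarrier.law_false_of_junta, @PovertyBarrier.law_false_of_sparse_rows,
   @PovertyBarrier.cheapOn_argmax_class, @PovertyBarrier.no_instance_of_rich_class⟩


/-- §8c T1 of the census (rev 13.2): val-idea-44 g1's TWISTED-FACE corona-zone elimination in THEOREMS, by name (port A ✓ p691572 `…ConePricingTwistedFaceZones` ·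
B kernel ✓ p693246 `…ConePricingTwistedFace`, source Cruxes `TwistedFace44` @6d4ae4b3db08; crit-9 V#119b / V#120b / V#132): the mirrored twisted family has `3^n` distinct zone
correlations, so no `(R+1)·2^n < 3^n` extended formulation reads them all (T0 (E-0) elimination of the corona-zone template). -/
theorem twisted_face_of_record :
    StatementOf @ConePricing.TwistedFace.mirror_three_pow_le ∧ StatementOf @ConePricing.TwistedFace.zCorAll_three_pow_le ∧
    StatementOf @ConePricing.TwistedFace.zCorAll_not_hasEF :=
  ⟨@ConePricing.TwistedFace.mirror_three_pow_le, @ConePricing.TwistedFace.zCorAll_three_pow_le, @ConePricing.TwistedFace.zCorAll_not_hasEF⟩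


/-- ROW 13 of the census (rev 13.3): val-idea-41 g6's SHORT LISTS — the list-length floor PROP A in THEOREMS, by name (✓ p661097
`…Theorems.FifoMatching.XcDivision.corPolytopeGraph_top_add_hull_three_pow_le`: `3^h ≤ N·(r+1)·2^h` for every size-`r` extended formulation of `COR(K_h) + conv{q_1,…,q_N}`,
`N ≥ 1` = the list length, = `K+1` for the census's `Fam h K`; crit-9 g4 V#150);
crit-9 g4 V#143c: (E-7) COUNT FLOOR OF RECORD «an enemy list / passenger polytope has `N ≥ 1.5^h/(T c h + 1)` members»; the 21181-currency corollaries
`ListFloor41.enemy_list_floor_T/_real/shortList_decided` (Cruxes @0b6e211dddc0) are two-liners over this name and are not ported (V#143c «nothing to port»). -/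
theorem short_lists_of_record : StatementOf @XcDivision.corPolytopeGraph_top_add_hull_three_pow_le :=
  @XcDivision.corPolytopeGraph_top_add_hull_three_pow_le

/-- ROW G′ of the census (rev 13.3; part B conjuncts 13.4): val-idea-41 g6's PATTERN SPLIT in THEOREMS, by name (part A ✓ p694365 `…Theorems.FifoMatchingNNDivisionHardLocalizationPatternSplit` · part B ✓ p695482 `…PatternSplitDefects`; source Cruxes `PatternSplit41`
@db0e975a6158; crit-9 g4 V#141a KEPT — STRUCTURAL, V#146a): defect-tolerant KW `3^m ≤ (r+1)·2^m + #defects`, the Minkowski split of a UDISJ pattern on `P + Q`, the budget-free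
equivalence `uPatAt_iff`; genus I ⊆ I′, `UPatD` decided, Euclidean-ball immunity (T6).  Caveat of record (V#141a (β)): I′ ⊇ I at the level of PATTERNS only. -/
theorem pattern_split_of_record :
    StatementOf @PatternSplit.three_pow_le_add_card_defects ∧
    StatementOf @PatternSplit.exists_split ∧
    StatementOf @PatternSplit.uPatAt_iff ∧
    StatementOf @PatternSplit.uPatF_succ_le_uPatDF ∧
    StatementOf @PatternSplit.uPatD_decided ∧
    StatementOf @PatternSplit.no_pattern_euclidBall :=
  ⟨@PatternSplit.three_pow_le_add_card_defects, @PatternSplit.exists_split, @PatternSplit.uPatAt_iff, @PatternSplit.uPatF_succ_le_uPatDF, @PatternSplit.uPatD_decided, @PatternSplit.no_pattern_euclidBall⟩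

/-- ROW 12 of the census (rev 13.4): val-idea-38 g4's ZONOTOPE CLOSURE LEMMA in THEOREMS, by name (✓ p694683 `Summits.ValiantsHypothesis.ValiantsHypothesis.Theorems.FifoMatchingNNDivisionHardExactPencilSubexpCube`; source Cruxes `ExactPencil38c`
@e32933e05cb2; crit-9 g4 V#138b / V#140b): every affine cube passenger with `N + K(c,n) < 2^{⌊n/4K⌋}` generators is DECIDED, no hypothesis on the generators. -/
theorem subexp_cube_of_record : StatementOf @ExactPencil.SubexpCube.cor_add_subexpGenCube_decided :=
  @ExactPencil.SubexpCube.cor_add_subexpGenCube_decided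


end Summit.ValiantsHypothesis.ValiantsHypothesis.Cruxes.NNDivisionHard.ValIdea40Census

#print axioms Summit.ValiantsHypothesis.ValiantsHypothesis.Cruxes.NNDivisionHard.ValIdea40Census.decided_species_of_record
#print axioms Summit.ValiantsHypothesis.ValiantsHypothesis.Cruxes.NNDivisionHard.ValIdea40Census.exactPencil_species_of_record
#print axioms Summit.ValiantsHypothesis.ValiantsHypothesis.Cruxes.NNDivisionHard.ValIdea40Census.currencies_of_record
#print axioms Summit.ValiantsHypothesis.ValiantsHypothesis.Cruxes.NNDivisionHard.ValIdea40Census.exactPencil_cube_species_of_record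
#print axioms Summit.ValiantsHypothesis.ValiantsHypothesis.Cruxes.NNDivisionHard.ValIdea40Census.pencil_collapse_of_record
#print axioms Summit.ValiantsHypothesis.ValiantsHypothesis.Cruxes.NNDivisionHard.ValIdea40Census.genus_functor_of_record
#print axioms Summit.ValiantsHypothesis.ValiantsHypothesis.Cruxes.NNDivisionHard.ValIdea40Census.poverty_barrier_of_record
#print axioms Summit.ValiantsHypothesis.ValiantsHypothesis.Cruxes.NNDivisionHard.ValIdea40Census.twisted_face_of_record
#print axioms Summit.ValiantsHypothesis.ValiantsHypothesis.Cruxes.NNDivisionHard.ValIdea40Census.short_lists_of_record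
#print axioms Summit.ValiantsHypothesis.ValiantsHypothesis.Cruxes.NNDivisionHard.ValIdea40Census.pattern_split_of_record
#print axioms Summit.ValiantsHypothesis.ValiantsHypothesis.Cruxes.NNDivisionHard.ValIdea40Census.subexp_cube_of_record
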